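import Summits.ResolutionOfSingularities.ResolutionOfSingularities.Theorems.ShallowPort6
import Summits.ResolutionOfSingularities.ResolutionOfSingularities.Theorems.MaxContactCutTightDefect

/-!
# MaxContactCut / ShallowPort (7/7) — the shallow column aside `MaxContactCut.PolyPureTowersShallow` (item 31768)
MODULO THE REGISTERED FACT `CossartPiltant2019LocalPermissible` ALONE

Node «ShallowPort» of cell `decomp-res-lens-5` (RESIDUAL MODE, lens «finite/base range + asymptotic regime + bridge»,
g38; critic ROW 232, door (M-Shallow)).  Slices 1–6 (`…Theorems.ShallowPort1` … `ShallowPort6`) prove the typed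
valuative port `TightDefectClasses.ShallowColumnPort` with NO hypothesis (`ShallowPort.shallowColumnPort_holds`: the
forced tower IS Cossart–Piltant's local Hironaka-permissible sequence along the Chevalley valuation ring of its stalk
chain; Bennett's normal flatness pins their centres to the points; stage `0` of a rooted tower is their Thm 1.5 (i)
frame).  This file reads the consequence in the host route's vocabulary through the landed
`MaxContactCutTightDefect.polyPureTowersShallow_of_cp` / `polyPureTowersTerminate_of_cp`, whose binder
`(hV : ShallowColumnPort)` is now DISCHARGED BY NAME: the `e = 1` column of the polynomial-pure slice holds modulo
the print theorem [CossartPiltant2019, Thm. 1.5] registered as `CossartPiltant2019LocalPermissible`, and the whole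
slice `PolyPureTowersTerminate` hangs on the dictionary port and the deep residual aside only.

Sources: [CossartPiltant2019] Thm. 1.5, Def. 2.3; [CossartJannsenSaito2020] Thm. 3.3.  AI-written; weaker than
expert review.
-/

set_option linter.dupNamespace false

open Literature.AlgebraicGeometry.Resolution
open Summit.ResolutionOfSingularities.ResolutionOfSingularities.Theses
open Summit.ResolutionOfSingularities.ResolutionOfSingularities.Theorems.TightDefectClasses

namespace Summit.ResolutionOfSingularities.ResolutionOfSingularities.Theorems.MaxContactCutShallowPort

/-- Landed-tree probe: the port constant, by the hypothesis-free theorem of slice 6. [folklore] -/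
example : Summit.ResolutionOfSingularities.ResolutionOfSingularities.Theorems.TightDefectClasses.ShallowColumnPort :=
  ShallowPort.shallowColumnPort_holds

/-- **The shallow column aside modulo the CP fact alone** («prover target #20» with its port binder discharged):
`CossartPiltant2019LocalPermissible → MaxContactCut.PolyPureTowersShallow`. [cite: CossartPiltant2019, Thm. 1.5] -/
theorem polyPureTowersShallow_of_cp (hCP : CossartPiltant2019LocalPermissible.{0}) :
    MaxContactCut.PolyPureTowersShallow :=
  MaxContactCutTightDefect.polyPureTowersShallow_of_cp hCP ShallowPort.shallowColumnPort_holds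

/-- **The polynomial-pure slice modulo the CP fact, the dictionary port and the deep residual aside** — the landed
`MaxContactCutTightDefect.polyPureTowersTerminate_of_cp` with `(hV : ShallowColumnPort)` discharged. [folklore] -/
theorem polyPureTowersTerminate_of_cp (hCP : CossartPiltant2019LocalPermissible.{0}) (hT : TowerDictionary)
    (hΔ : MaxContactCut.DefectWalksDeep) : PolyPureTowersTerminate :=
  MaxContactCutTightDefect.polyPureTowersTerminate_of_cp hCP ShallowPort.shallowColumnPort_holds hT hΔ

/-- **The two column asides modulo the CP fact and the deep column**: `PolyPureTowersTerminate` from CP and the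
`e ≥ 2` column alone. [folklore] -/
theorem polyPureTowersTerminate_of_cp_of_deep (hCP : CossartPiltant2019LocalPermissible.{0})
    (h₂ : PolyPureTowersTerminateDeep) : PolyPureTowersTerminate :=
  polyPureTowersTerminate_of_columns (ShallowPort.polyPureTowersTerminateShallow_of_cp hCP) h₂

end Summit.ResolutionOfSingularities.ResolutionOfSingularities.Theorems.MaxContactCutShallowPort
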